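import Mathlib
import Literature.Probability.Percolation.Crossings
import Literature.Probability.RandomPlanarGeometry.CardyFunction

/-!
# Sketch — crux idea `excursion-cross-ratio` for `RectilinearCardy` (stmt-CriticalPhenomena-5660)

INTRINSIC (map-free, corner-free, constant-free) form of Cardy's formula on a lattice polygon
`V ⊆ ℤ²` with four boundary marks `a, b, c, d` in cyclic order:

  `P_{1/2}[(ab) ↔ (cd) in V] - F(η_V(a,b,c,d)) → 0`,
  `η_V(a,b,c,d) := √( G_V(a,c) G_V(b,d) / (G_V(a,b) G_V(c,d)) )`,

where `G_V` is the Green's function of simple random walk on `ℤ²` KILLED ON LEAVING `V`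
(so boundary and corner vertices of the polygon are legitimate arguments; every lattice-local
normalisation of `G_V` at a mark appears once upstairs and once downstairs and cancels).
Continuum reason: for the boundary excursion Poisson kernel `H` of a Jordan domain,
`crossRatio(w_a,w_b,w_c,w_d)² = H(a,c)H(b,d)/(H(a,b)H(c,d))` for ANY uniformizing map `w`
(the Jacobians `|w'(·)|` cancel), and `η + (1-η) = 1` becomes the Ptolemy identity
`(H_ab H_cd)^{-1/2} + (H_ad H_bc)^{-1/2} = (H_ac H_bd)^{-1/2}`.
First lemmas below: the rectangle instances (corner marks = Kleban–Zagier's family; one free mark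
on the right side = the integrated exit law of the lowest crossing) and the discrete Ptolemy
sanity statement. Everything is over tree declarations (`rectangle`, `leftSide`, `rightSide`,
`crossingProb`, `openConnIn`, `bondPercolation`, `zdGraph`, `half`, `cardyFunction`) plus the
three local definitions `killedKernel`, `killedGreen`, `excursionEta`.
-/

noncomputable section

open Filter Topology
open Literature.Probability.Percolation Literature.Probability.LatticeModels
open Literature.Probability.RandomPlanarGeometry

namespace Summit.CriticalPhenomena.CardyFormulaZ2.Cruxes.RectilinearCardy.ExcursionCrossRatio

open Classical in
/-- Sub-Markov kernel of simple random walk on `ℤ²` restricted to the finite vertex set `V`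
(the walk is killed when it steps outside `V`): `P(u,v) = 1/4` if `u ~ v` in `ℤ²`, else `0`. -/
def killedKernel (V : Finset (Site 2)) : Matrix V V ℝ :=
  fun u v => if (zdGraph 2).Adj u.1 v.1 then (1 / 4 : ℝ) else 0

open Classical in
/-- Green's function of simple random walk on `ℤ²` killed on leaving `V`:
`G_V(x,y) = Σ_k P^k(x,y) = (1 - P)⁻¹(x,y)` (expected number of visits to `y` before exit,
starting at `x`); junk value `0` if `x ∉ V` or `y ∉ V`. Symmetric in `x, y`. -/
def killedGreen (V : Finset (Site 2)) (x y : Site 2) : ℝ :=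
  if h : x ∈ V ∧ y ∈ V then ((1 : Matrix V V ℝ) - killedKernel V)⁻¹ ⟨x, h.1⟩ ⟨y, h.2⟩ else 0

/-- The DISCRETE EXCURSION CROSS-RATIO of four marks of the lattice polygon `V`:
`η_V(a,b,c,d) = √(G(a,c)G(b,d) / (G(a,b)G(c,d)))`. For boundary marks of `nΩ ∩ ℤ²`, `Ω` a
rectilinear polygon, it is predicted to converge to the conformal cross-ratio of `(Ω; a,b,c,d)`
(weight-1 covariance of the excursion Poisson kernel; all Jacobians cancel). -/
def excursionEta (V : Finset (Site 2)) (a b c d : Site 2) : ℝ :=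
  Real.sqrt (killedGreen V a c * killedGreen V b d / (killedGreen V a b * killedGreen V c d))

/-- FIRST LEMMA (corner-marked rectangles = Kleban–Zagier's family, intrinsic form):
the `P_{1/2}` left–right crossing probability of the lattice rectangle `[0,pn]×[0,qn]` minus
Cardy's function of the DISCRETE excursion cross-ratio of its four corners tends to `0`.
Marks: `a = (0,qn)`, `b = (0,0)` (ends of the left side), `c = (pn,0)`, `d = (pn,qn)`. -/
def IntrinsicCardyBox : Prop :=
  ∀ p q : ℕ, 1 ≤ p → 1 ≤ q →
    Tendsto (fun n : ℕ ↦ crossingProb half (p * n) (q * n) -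
      cardyFunction (excursionEta (rectangle (p * n) (q * n))
        ![0, ((q * n : ℕ) : ℤ)] ![0, 0] ![((p * n : ℕ) : ℤ), 0] ![((p * n : ℕ) : ℤ), ((q * n : ℕ) : ℤ)]))
      atTop (𝓝 0)

/-- FIRST LEMMA, free fourth mark (the integrated exit law of the lowest crossing): left side of
`[0,pn]×[0,qn]` joined inside the rectangle to the part of the right side at height `≤ ⌊t·qn⌋`,
minus Cardy's function of the discrete excursion cross-ratio with `d = (pn, ⌊t·qn⌋)`, tends to `0`. -/
def IntrinsicCardyFreeMark : Prop :=
  ∀ p q : ℕ, 1 ≤ p → 1 ≤ q → ∀ t : ℝ, 0 < t → t < 1 →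
    Tendsto (fun n : ℕ ↦
      (bondPercolation (zdGraph 2) half).real
        {ω | ∃ x ∈ (leftSide (p * n) (q * n) : Set (Site 2)), ∃ y ∈ (rightSide (p * n) (q * n) : Set (Site 2)),
          y 1 ≤ ⌊t * (q * n : ℕ)⌋ ∧ ω ∈ openConnIn (rectangle (p * n) (q * n) : Set (Site 2)) x y} -
      cardyFunction (excursionEta (rectangle (p * n) (q * n))
        ![0, ((q * n : ℕ) : ℤ)] ![0, 0] ![((p * n : ℕ) : ℤ), 0] ![((p * n : ℕ) : ℤ), ⌊t * (q * n : ℕ)⌋]))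
      atTop (𝓝 0)

/-- SANITY / SUPPORT (pure discrete potential theory, provable-now class): the discrete Ptolemy
identity `η_V(a,b,c,d) + η_V(b,c,d,a) → 1` on corner-marked rectangles — the lattice shadow of
`η + (1 - η) = 1`, i.e. of `(H_ab H_cd)^{-1/2} + (H_ad H_bc)^{-1/2} = (H_ac H_bd)^{-1/2}` for the
excursion Poisson kernel; it certifies that the killed-walk normalisations at corners cancel. -/
def DiscretePtolemyBox : Prop :=
  ∀ p q : ℕ, 1 ≤ p → 1 ≤ q →
    Tendsto (fun n : ℕ ↦
      excursionEta (rectangle (p * n) (q * n))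
          ![0, ((q * n : ℕ) : ℤ)] ![0, 0] ![((p * n : ℕ) : ℤ), 0] ![((p * n : ℕ) : ℤ), ((q * n : ℕ) : ℤ)] +
        excursionEta (rectangle (p * n) (q * n))
          ![0, 0] ![((p * n : ℕ) : ℤ), 0] ![((p * n : ℕ) : ℤ), ((q * n : ℕ) : ℤ)] ![0, ((q * n : ℕ) : ℤ)])
      atTop (𝓝 1)

/-- EXACT DUALITY consistency (provable now from tree duality once `DiscretePtolemyBox` holds):
Cardy's function of the two complementary discrete cross-ratios sums to `1` in the limit —
`F(η) + F(1-η) = 1` needs `cardyFunction_one_sub`-type symmetry of `F`. Stated as a target. -/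
def IntrinsicDualityBox : Prop :=
  ∀ p q : ℕ, 1 ≤ p → 1 ≤ q →
    Tendsto (fun n : ℕ ↦
      cardyFunction (excursionEta (rectangle (p * n) (q * n))
          ![0, ((q * n : ℕ) : ℤ)] ![0, 0] ![((p * n : ℕ) : ℤ), 0] ![((p * n : ℕ) : ℤ), ((q * n : ℕ) : ℤ)]) +
        cardyFunction (excursionEta (rectangle (p * n) (q * n))
          ![0, 0] ![((p * n : ℕ) : ℤ), 0] ![((p * n : ℕ) : ℤ), ((q * n : ℕ) : ℤ)] ![0, ((q * n : ℕ) : ℤ)]))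
      atTop (𝓝 1)


/-! ### Card B (`rank-one-ward-carving`): the rank-one Ward identity

Deleting a boundary vertex `v` of a lattice polygon `V` changes (i) the crossing probability by the
EXACT one-term Russo increment `P_V[E] - P_{V∖v}[E] = P_V[v is vertex-pivotal for E]`, and (ii) the
killed Green's function by the EXACT rank-one update `G_{V∖v}(x,y) = G_V(x,y) - G_V(x,v)G_V(v,y)/G_V(v,v)`,
hence the discrete excursion cross-ratio by an explicit factor. The conjectured local law ("rank-one
Ward identity"): the two increments of `P` and of `F(η_V)` agree to relative `o(1)`, uniformly over
boundary vertices at macroscopic distance from the marks. Summed along an outer shelling of the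
bounding rectangle down to `V` it carries Cardy from Kleban–Zagier's rectangles to every polyomino. -/

/-- RANK-ONE WARD IDENTITY on the corner-marked rectangle, bottom-side vertex `v = (⌊s·pn⌋, 0)`:
`n² · [ (P_V[LR] - P_{V∖v}[LR]) - (F(η_V) - F(η_{V∖v})) ] → 0` (both increments are of order `n⁻²`:
half-plane 3-arm exponent `2`, universal on `ℤ²`). -/
def RankOneWardBox : Prop :=
  ∀ p q : ℕ, 1 ≤ p → 1 ≤ q → ∀ s : ℝ, 0 < s → s < 1 →
    Tendsto (fun n : ℕ ↦ ((n : ℝ) ^ 2) *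
      (((bondPercolation (zdGraph 2) half).real (lrCrossing (p * n) (q * n)) -
          (bondPercolation (zdGraph 2) half).real
            (openCrossing (((rectangle (p * n) (q * n)).erase ![⌊s * (p * n : ℕ)⌋, 0] : Finset (Site 2)) : Set (Site 2))
              (leftSide (p * n) (q * n) : Set (Site 2)) (rightSide (p * n) (q * n) : Set (Site 2)))) -
        (cardyFunction (excursionEta (rectangle (p * n) (q * n))
            ![0, ((q * n : ℕ) : ℤ)] ![0, 0] ![((p * n : ℕ) : ℤ), 0] ![((p * n : ℕ) : ℤ), ((q * n : ℕ) : ℤ)]) -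
          cardyFunction (excursionEta ((rectangle (p * n) (q * n)).erase ![⌊s * (p * n : ℕ)⌋, 0])
            ![0, ((q * n : ℕ) : ℤ)] ![0, 0] ![((p * n : ℕ) : ℤ), 0] ![((p * n : ℕ) : ℤ), ((q * n : ℕ) : ℤ)]))))
      atTop (𝓝 0)

/-- SIDE-INTEGRATED (row) Ward identity — the cheap shadow testable by exact transfer matrices at
small widths: removing the bottom row of `[0,pn]×[0,qn]` is, by translation invariance, the rectangle
`[0,pn]×[0,qn-1]`; the aspect-ratio increment of the crossing probability matches the increment of
the intrinsic predictor to order `o(1/n)`. -/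
def RowWardBox : Prop :=
  ∀ p q : ℕ, 1 ≤ p → 1 ≤ q →
    Tendsto (fun n : ℕ ↦ (n : ℝ) *
      ((crossingProb half (p * n) (q * n) - crossingProb half (p * n) (q * n - 1)) -
        (cardyFunction (excursionEta (rectangle (p * n) (q * n))
            ![0, ((q * n : ℕ) : ℤ)] ![0, 0] ![((p * n : ℕ) : ℤ), 0] ![((p * n : ℕ) : ℤ), ((q * n : ℕ) : ℤ)]) -
          cardyFunction (excursionEta (rectangle (p * n) (q * n - 1))
            ![0, ((q * n - 1 : ℕ) : ℤ)] ![0, 0] ![((p * n : ℕ) : ℤ), 0] ![((p * n : ℕ) : ℤ), ((q * n - 1 : ℕ) : ℤ)]))))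
      atTop (𝓝 0)

end Summit.CriticalPhenomena.CardyFormulaZ2.Cruxes.RectilinearCardy.ExcursionCrossRatio

end
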